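import Summits.QuantumFields.BalabanUV.Beta.GAN24.LayerPushGaugeTable

/-!
# `BalabanUV.Beta.GAN24.SlotWardCompanion` — binder row G-an2-4 ∕ (CONV-C), W-slot CT-W, route «WC-TL» ∕ «QR-LL», row **(LT-Δ) «LAYER TRANSPORT»**, K-LL-4:
# **THE SLOT-WARD COMPANION IS THE LETTER's SLOT DIVERGENCE** — under the slot-Ward binder of `LayerPushGaugeTable` §1 the companion `S₀` is NOT a free datum:
# off the diagonal it is `−(divV S x) x z = (divV S z) x z` (an2's `KernelWard.divV`, the slot divergence of the letter family), the slot divergence at any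
# third site vanishes on the ff block, the binder holds with the CANONICAL companion `x z ↦ −(divV S x) x z`, and that companion inherits the letter's (LAY)
# profile row: `|S₀ x z κ₁ κ₂| ≤ Cs·(Σ_κ (ω (x − e_κ) + ω x))·e^{−m′‖z − x‖₁}` — LETTER-SIZED AT THE LETTER's SLOTS (no hidden smallness in the companion)

NOT IN PRINT; OUR BOOKKEEPING ([folklore] the binder evaluated at the indicator gauge functions `ψ = 𝟙_{y}`; G-an2-4 formalisation swarm, leaf prover
`b2b-balaban-gan24-formalise-leaf-01`, gen 66).  HONEST FRAMING (cell contract, verbatim): «discharging `BetaPertH` makes Bałaban's UV stability UNCONDITIONAL — a real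
constructive-QFT result; it is NOT the continuum limit and NOT the Clay problem.»  HONEST DEPENDENCY (verbatim): «continuum YM on T⁴ ⇐ BetaPertH ∧ nine spine estimates
(0/9 proved); BetaPertH ⇐ (D1) ∧ (D4) ∧ CAP+tail; G-an2-4 gates asym, D1 and NE2/3/4.»

## What (generic `d`; a letter family `S κ u` and a companion `S₀` under the slot-Ward binder
## `hWard : ∀ ψ x z κ₁ κ₂, Σ_κ Σ'_u dz ψ κ u · S κ u x z κ₁ κ₂ = S₀ x z κ₁ κ₂ · (ψ z − ψ x)`)
§1 `dz_indicator`, `tsum_dz_indicator_mul` (the slot sum against the indicator gauge `𝟙_{y}` is the backward slot difference at `y`), `sum_tsum_dz_indicator_eq_divV`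
   (summed over directions it is an2's `KernelWard.divV S y`, after the `unitVec` conventions bridge `AveragingWardStencils.b6UnitVec_eq`).
§2 THE DICTIONARY: **`companion_eq_neg_divV_left`** (`x ≠ z ⇒ S₀ x z κ₁κ₂ = −(divV S x) x z κ₁κ₂`), **`companion_eq_divV_right`** (`x ≠ z ⇒ S₀ x z κ₁κ₂ = (divV S z) x z κ₁κ₂`),
   **`divV_ff_eq_zero_of_ne`** (`y ≠ x, y ≠ z ⇒ (divV S y) x z κ₁κ₂ = 0` — the letter's slot divergence is supported on the two kernel sites), `divV_left_add_divV_right`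
   (`x ≠ z ⇒ (divV S x) x z + (divV S z) x z = 0` on the ff block), `slot_sum_diag_eq_zero` (at `x = z` the slot contraction of any pure gauge vanishes; the binder
   does not see the companion's diagonal), **`slotWard_canonical`** (the binder holds with the CANONICAL companion `x z ↦ −(divV S x) x z`).
§3 THE SIZE: **`abs_divV_ff_le_of_profile`** ∕ `abs_divV_ff_le_of_profile_right` and **`abs_canonical_companion_le_of_profile`**; §4 `abs_companion_le_of_profile` (any companion, off the diagonal, row and column forms): under the (LAY) profile row
   `|S κ u x z a b| ≤ Cs·ω u·e^{−m′(‖x−u‖₁+‖z−u‖₁)}` (`0 ≤ m′`, `0 ≤ ω`), `|(divV S x) x z κ₁κ₂| ≤ Cs·(Σ_κ (ω (x − e_κ) + ω x))·e^{−m′‖z − x‖₁}` for ALL `x z` — the shape of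
   `LayerPushGaugeTableCell`'s ∕ `LayerSeamLettersFubini`'s companion hypothesis `hS₀` with `C₀ = Cs`, row weight `ω₀ x = Σ_κ (ω (x − e_κ) + ω x)`, rate `m′`.
READING (displayed, not claimed beyond the theorems): in the (b3) commutator cell `Σ_{x,z} l(x)·S₀(x,z)·(λ z − λ x)·r(z)` the companion is as large as the letter at the
letter's own slots; for a sub-letter whose (LAY) weight `ω` sits on the crossing bonds of its block's boundary — where the dressed legs' gauge part has its full
inter-block jump — the cell's absolute count therefore carries no factor beyond `Cs × (legs) × (jump) × (layer)`; K-LL-4 is NOT advanced by this file, only located.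
[folklore]; 0 cited facts, 0 `def`, 0 `def … : Prop`, 0 sorry.  NOTHING of (Q-R)∕(LT)∕(Q-L)∕(C)∕(S)∕«T2Shape»∕«T2Drift»∕(hW, hWall) discharged; NEVER «G-an2-4 closed» as
(CONV-C); NOT D1, NOT `BetaPertH`, NOT continuum, NOT Clay.  2026-08-22; no existing file touched.
-/

noncomputable section

open Finset
open scoped BigOperators
open Literature.MathematicalPhysics.QuantumFieldTheory
open Literature.MathematicalPhysics.QuantumFieldTheory.Balaban1983to89
open Literature.MathematicalPhysics.QuantumFieldTheory.Balaban1983to89.Beta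
open B12Sec2to5 (l1 l1_nonneg)
open ExpKernelCalculus (MKer Site)
open OneStepResolventKernel (Fib)
open AffineAveraging (dz)
open KernelWard (divV)
open AveragingWardStencils (b6UnitVec_eq)

namespace Summit.QuantumFields.BalabanUV.Beta.GAN24.SlotWardCompanion

variable {d : ℕ}

/-! ## §1 The slot sum against an indicator gauge function -/

open Classical in
/-- [folklore] The unit difference of the indicator of `y`: `dz 𝟙_{y} κ u = 𝟙[u = y − e_κ] − 𝟙[u = y]`. -/
theorem dz_indicator (y : Site (d + 1)) (κ : Fin (d + 1)) (u : Site (d + 1)) :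
    dz (fun v : Site (d + 1) => if v = y then (1 : ℝ) else 0) κ u
      = (if u = y - AffineAveraging.unitVec κ then (1 : ℝ) else 0) - (if u = y then (1 : ℝ) else 0) := by
  simp only [dz]
  congr 1
  by_cases h : u = y - AffineAveraging.unitVec κ
  · rw [if_pos (show u + AffineAveraging.unitVec κ = y by rw [h, sub_add_cancel]), if_pos h]
  · rw [if_neg (show u + AffineAveraging.unitVec κ ≠ y from fun h' => h (by rw [← h', add_sub_cancel_right])), if_neg h]

/-- [folklore] `e_κ ≠ 0`, so `y − e_κ ≠ y`. -/
theorem sub_unitVec_ne (y : Site (d + 1)) (κ : Fin (d + 1)) : y - AffineAveraging.unitVec κ ≠ y := by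
  intro h
  have h1 : AffineAveraging.unitVec (d := d + 1) κ = 0 := by
    have := congrArg (fun v => y - v) h
    simpa using this
  have h2 := congrFun h1 κ
  simp [AffineAveraging.unitVec] at h2

open Classical in
/-- [folklore] **THE SLOT SUM AGAINST THE INDICATOR GAUGE `𝟙_{y}` IS THE BACKWARD SLOT DIFFERENCE AT `y`**: for any `f`,
`Σ'_u dz 𝟙_{y} κ u · f u = f (y − e_κ) − f y` (a two-point support; no summability hypothesis). -/
theorem tsum_dz_indicator_mul (y : Site (d + 1)) (κ : Fin (d + 1)) (f : Site (d + 1) → ℝ) :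
    ∑' u : Site (d + 1), dz (fun v : Site (d + 1) => if v = y then (1 : ℝ) else 0) κ u * f u = f (y - AffineAveraging.unitVec κ) - f y := by
  have hne := sub_unitVec_ne y κ
  rw [tsum_eq_sum (s := ({y - AffineAveraging.unitVec κ, y} : Finset (Site (d + 1)))) ?_]
  · rw [Finset.sum_pair hne, dz_indicator, dz_indicator, if_pos rfl, if_neg hne.symm, if_neg hne, if_pos rfl]
    ring
  · intro u hu
    rw [Finset.mem_insert, Finset.mem_singleton, not_or] at hu
    rw [dz_indicator, if_neg hu.1, if_neg hu.2, sub_zero, zero_mul]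

open Classical in
/-- [folklore] Summed over the directions, the slot contraction of the letter family against `𝟙_{y}` is an2's slot divergence `KernelWard.divV S y`, entrywise
(`B6BondElimination.unitVec = AffineAveraging.unitVec`, `AveragingWardStencils.b6UnitVec_eq`). -/
theorem sum_tsum_dz_indicator_eq_divV (S : Fin (d + 1) → Site (d + 1) → MKer (d + 1) (Fib d)) (y x z : Site (d + 1)) (a b : Fib d) :
    ∑ κ : Fin (d + 1), ∑' u : Site (d + 1), dz (fun v : Site (d + 1) => if v = y then (1 : ℝ) else 0) κ u * S κ u x z a b
      = divV S y x z a b := by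
  simp only [divV, Finset.sum_apply, Pi.sub_apply, b6UnitVec_eq]
  exact Finset.sum_congr rfl fun κ _ => tsum_dz_indicator_mul y κ (fun u => S κ u x z a b)

/-! ## §2 The dictionary: the companion is the slot divergence -/

section Dictionary

variable {S : Fin (d + 1) → Site (d + 1) → MKer (d + 1) (Fib d)} {S₀ : MKer (d + 1) (Fib d)}
  (hWard : ∀ (ψ : Site (d + 1) → ℝ) (x z : Site (d + 1)) (κ₁ κ₂ : Fin (d + 1)),
    ∑ κ : Fin (d + 1), ∑' u : Site (d + 1), dz ψ κ u * S κ u x z (Sum.inl κ₁) (Sum.inl κ₂)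
      = S₀ x z (Sum.inl κ₁) (Sum.inl κ₂) * (ψ z - ψ x))

include hWard in
open Classical in
/-- NOT IN PRINT; OUR BOOKKEEPING.  **THE COMPANION IS MINUS THE SLOT DIVERGENCE AT THE ROW SITE**: for `x ≠ z`, `S₀ x z κ₁ κ₂ = −(divV S x) x z κ₁ κ₂` (the binder at `ψ = 𝟙_{x}`). -/
theorem companion_eq_neg_divV_left {x z : Site (d + 1)} (hxz : x ≠ z) (κ₁ κ₂ : Fin (d + 1)) :
    S₀ x z (Sum.inl κ₁) (Sum.inl κ₂) = -(divV S x x z (Sum.inl κ₁) (Sum.inl κ₂)) := by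
  have h := hWard (fun v => if v = x then (1 : ℝ) else 0) x z κ₁ κ₂
  rw [sum_tsum_dz_indicator_eq_divV, if_neg (Ne.symm hxz), if_pos rfl] at h
  linarith

include hWard in
open Classical in
/-- NOT IN PRINT; OUR BOOKKEEPING.  **THE COMPANION IS THE SLOT DIVERGENCE AT THE COLUMN SITE**: for `x ≠ z`, `S₀ x z κ₁ κ₂ = (divV S z) x z κ₁ κ₂` (the binder at `ψ = 𝟙_{z}`). -/
theorem companion_eq_divV_right {x z : Site (d + 1)} (hxz : x ≠ z) (κ₁ κ₂ : Fin (d + 1)) :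
    S₀ x z (Sum.inl κ₁) (Sum.inl κ₂) = divV S z x z (Sum.inl κ₁) (Sum.inl κ₂) := by
  have h := hWard (fun v => if v = z then (1 : ℝ) else 0) x z κ₁ κ₂
  rw [sum_tsum_dz_indicator_eq_divV, if_pos rfl, if_neg hxz] at h
  linarith

include hWard in
open Classical in
/-- NOT IN PRINT; OUR BOOKKEEPING.  **THE LETTER's SLOT DIVERGENCE IS SUPPORTED ON THE TWO KERNEL SITES** (ff block): for `y ≠ x`, `y ≠ z`, `(divV S y) x z κ₁ κ₂ = 0`
(the binder at `ψ = 𝟙_{y}`: the gauge function vanishes at both kernel sites). -/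
theorem divV_ff_eq_zero_of_ne {y x z : Site (d + 1)} (hyx : y ≠ x) (hyz : y ≠ z) (κ₁ κ₂ : Fin (d + 1)) :
    divV S y x z (Sum.inl κ₁) (Sum.inl κ₂) = 0 := by
  have h := hWard (fun v => if v = y then (1 : ℝ) else 0) x z κ₁ κ₂
  rw [sum_tsum_dz_indicator_eq_divV, if_neg (Ne.symm hyz), if_neg (Ne.symm hyx), sub_zero, mul_zero] at h
  exact h

include hWard in
/-- NOT IN PRINT; OUR BOOKKEEPING.  The slot divergences at the two kernel sites cancel on the ff block: for `x ≠ z`, `(divV S x) x z κ₁κ₂ + (divV S z) x z κ₁κ₂ = 0`. -/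
theorem divV_left_add_divV_right {x z : Site (d + 1)} (hxz : x ≠ z) (κ₁ κ₂ : Fin (d + 1)) :
    divV S x x z (Sum.inl κ₁) (Sum.inl κ₂) + divV S z x z (Sum.inl κ₁) (Sum.inl κ₂) = 0 := by
  rw [← companion_eq_divV_right hWard hxz, companion_eq_neg_divV_left hWard hxz, add_neg_cancel]

include hWard in
/-- NOT IN PRINT; OUR BOOKKEEPING.  On the diagonal `x = z` the slot contraction of the letter family against ANY gauge function vanishes (the binder's factor
`ψ x − ψ x`); in particular the binder does not constrain the companion's diagonal. -/
theorem slot_sum_diag_eq_zero (ψ : Site (d + 1) → ℝ) (x : Site (d + 1)) (κ₁ κ₂ : Fin (d + 1)) :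
    ∑ κ : Fin (d + 1), ∑' u : Site (d + 1), dz ψ κ u * S κ u x x (Sum.inl κ₁) (Sum.inl κ₂) = 0 := by
  rw [hWard, sub_self, mul_zero]

include hWard in
/-- NOT IN PRINT; OUR BOOKKEEPING.  **THE BINDER HOLDS WITH THE CANONICAL COMPANION** `x z ↦ −(divV S x) x z`: a letter family that admits SOME slot-Ward companion
admits the one read off its own slot divergence (off the diagonal they agree by `companion_eq_neg_divV_left`; on the diagonal both sides vanish). -/
theorem slotWard_canonical (ψ : Site (d + 1) → ℝ) (x z : Site (d + 1)) (κ₁ κ₂ : Fin (d + 1)) :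
    ∑ κ : Fin (d + 1), ∑' u : Site (d + 1), dz ψ κ u * S κ u x z (Sum.inl κ₁) (Sum.inl κ₂)
      = -(divV S x x z (Sum.inl κ₁) (Sum.inl κ₂)) * (ψ z - ψ x) := by
  by_cases hxz : x = z
  · subst hxz
    rw [slot_sum_diag_eq_zero hWard, sub_self, mul_zero]
  · rw [hWard, companion_eq_neg_divV_left hWard hxz]

end Dictionary

/-! ## §3 The size of the slot divergence under the (LAY) profile row -/

section Size

variable {S : Fin (d + 1) → Site (d + 1) → MKer (d + 1) (Fib d)} {ω : Site (d + 1) → ℝ} {Cs m' : ℝ}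
  (hCs : 0 ≤ Cs) (hm : 0 ≤ m') (hω : ∀ u, 0 ≤ ω u)
  (hS : ∀ k' u x z a b, |S k' u x z a b| ≤ Cs * ω u * Real.exp (-m' * (l1 (x - u) + l1 (z - u))))

include hCs hm hω hS in
/-- NOT IN PRINT; OUR BOOKKEEPING.  **THE SLOT DIVERGENCE AT THE ROW SITE IS LETTER-SIZED AT THE LETTER's SLOTS**: under the profile row
`|S κ u x z a b| ≤ Cs·ω u·e^{−m′(‖x−u‖₁+‖z−u‖₁)}` (`0 ≤ Cs`, `0 ≤ m′`, `0 ≤ ω`), for ALL `x z a b`: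
`|(divV S x) x z a b| ≤ Cs·(Σ_κ (ω (x − e_κ) + ω x))·e^{−m′‖z − x‖₁}`. -/
theorem abs_divV_ff_le_of_profile (x z : Site (d + 1)) (a b : Fib d) :
    |divV S x x z a b| ≤ Cs * (∑ κ : Fin (d + 1), (ω (x - B6BondElimination.unitVec κ) + ω x)) * Real.exp (-m' * l1 (z - x)) := by
  simp only [divV, Finset.sum_apply, Pi.sub_apply]
  refine (Finset.abs_sum_le_sum_abs _ _).trans ?_
  rw [Finset.mul_sum, Finset.sum_mul]
  refine Finset.sum_le_sum fun κ _ => ?_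
  set u : Site (d + 1) := x - B6BondElimination.unitVec κ with hu
  have hE : Real.exp (-m' * (l1 (x - u) + l1 (z - u))) ≤ Real.exp (-m' * l1 (z - x)) := by
    refine Real.exp_le_exp.2 ?_
    have ht : l1 (z - x) ≤ l1 (z - u) + l1 (u - x) := ExpKernelCalculus.l1_sub_triangle z u x
    rw [ExpKernelCalculus.l1_sub_symm u x] at ht
    nlinarith [l1_nonneg (x - u), l1_nonneg (z - u)]
  have h1 : |S κ u x z a b| ≤ Cs * ω u * Real.exp (-m' * l1 (z - x)) :=
    (hS κ u x z a b).trans (mul_le_mul_of_nonneg_left hE (mul_nonneg hCs (hω u)))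
  have h2 : |S κ x x z a b| ≤ Cs * ω x * Real.exp (-m' * l1 (z - x)) := by
    have h := hS κ x x z a b
    rw [sub_self, show l1 (0 : Site (d + 1)) = 0 by simp [l1], zero_add] at h
    exact h
  calc |S κ u x z a b - S κ x x z a b| ≤ |S κ u x z a b| + |S κ x x z a b| := abs_sub _ _
    _ ≤ Cs * ω u * Real.exp (-m' * l1 (z - x)) + Cs * ω x * Real.exp (-m' * l1 (z - x)) := add_le_add h1 h2
    _ = Cs * (ω u + ω x) * Real.exp (-m' * l1 (z - x)) := by ring

include hCs hm hω hS in
/-- NOT IN PRINT; OUR BOOKKEEPING.  **THE SLOT DIVERGENCE AT THE COLUMN SITE**, same size read on the column: for ALL `x z a b`,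
`|(divV S z) x z a b| ≤ Cs·(Σ_κ (ω (z − e_κ) + ω z))·e^{−m′‖x − z‖₁}`. -/
theorem abs_divV_ff_le_of_profile_right (x z : Site (d + 1)) (a b : Fib d) :
    |divV S z x z a b| ≤ Cs * (∑ κ : Fin (d + 1), (ω (z - B6BondElimination.unitVec κ) + ω z)) * Real.exp (-m' * l1 (x - z)) := by
  simp only [divV, Finset.sum_apply, Pi.sub_apply]
  refine (Finset.abs_sum_le_sum_abs _ _).trans ?_
  rw [Finset.mul_sum, Finset.sum_mul]
  refine Finset.sum_le_sum fun κ _ => ?_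
  set u : Site (d + 1) := z - B6BondElimination.unitVec κ with hu
  have hE : Real.exp (-m' * (l1 (x - u) + l1 (z - u))) ≤ Real.exp (-m' * l1 (x - z)) := by
    refine Real.exp_le_exp.2 ?_
    have ht : l1 (x - z) ≤ l1 (x - u) + l1 (u - z) := ExpKernelCalculus.l1_sub_triangle x u z
    rw [ExpKernelCalculus.l1_sub_symm u z] at ht
    nlinarith [l1_nonneg (x - u), l1_nonneg (z - u)]
  have h1 : |S κ u x z a b| ≤ Cs * ω u * Real.exp (-m' * l1 (x - z)) :=
    (hS κ u x z a b).trans (mul_le_mul_of_nonneg_left hE (mul_nonneg hCs (hω u)))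
  have h2 : |S κ z x z a b| ≤ Cs * ω z * Real.exp (-m' * l1 (x - z)) := by
    have h := hS κ z x z a b
    rw [sub_self, show l1 (0 : Site (d + 1)) = 0 by simp [l1], add_zero] at h
    exact h
  calc |S κ u x z a b - S κ z x z a b| ≤ |S κ u x z a b| + |S κ z x z a b| := abs_sub _ _
    _ ≤ Cs * ω u * Real.exp (-m' * l1 (x - z)) + Cs * ω z * Real.exp (-m' * l1 (x - z)) := add_le_add h1 h2
    _ = Cs * (ω u + ω z) * Real.exp (-m' * l1 (x - z)) := by ring

include hCs hm hω hS in
/-- NOT IN PRINT; OUR BOOKKEEPING.  **THE CANONICAL COMPANION INHERITS THE LETTER's PROFILE ROW** — the shape of `LayerPushGaugeTableCell`'s ∕ `LayerSeamLettersFubini`'s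
hypothesis `hS₀` with `C₀ = Cs`, ROW weight `ω₀ x = Σ_κ (ω (x − e_κ) + ω x)` and the letter's rate `m′`:
`|−(divV S x) x z a b| ≤ Cs·(Σ_κ (ω (x − e_κ) + ω x))·e^{−m′‖x − z‖₁}` for all `x z a b`. -/
theorem abs_canonical_companion_le_of_profile (x z : Site (d + 1)) (a b : Fib d) :
    |(-(divV S x x z a b))| ≤ Cs * (∑ κ : Fin (d + 1), (ω (x - B6BondElimination.unitVec κ) + ω x)) * Real.exp (-m' * l1 (x - z)) := by
  rw [abs_neg, ExpKernelCalculus.l1_sub_symm x z]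
  exact abs_divV_ff_le_of_profile hCs hm hω hS x z a b

end Size

/-! ## §4 The companion of a letter family under the binder AND the profile row -/

section Both

variable {S : Fin (d + 1) → Site (d + 1) → MKer (d + 1) (Fib d)} {S₀ : MKer (d + 1) (Fib d)}
  (hWard : ∀ (ψ : Site (d + 1) → ℝ) (x z : Site (d + 1)) (κ₁ κ₂ : Fin (d + 1)),
    ∑ κ : Fin (d + 1), ∑' u : Site (d + 1), dz ψ κ u * S κ u x z (Sum.inl κ₁) (Sum.inl κ₂)
      = S₀ x z (Sum.inl κ₁) (Sum.inl κ₂) * (ψ z - ψ x))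
  {ω : Site (d + 1) → ℝ} {Cs m' : ℝ} (hCs : 0 ≤ Cs) (hm : 0 ≤ m') (hω : ∀ u, 0 ≤ ω u)
  (hS : ∀ k' u x z a b, |S k' u x z a b| ≤ Cs * ω u * Real.exp (-m' * (l1 (x - u) + l1 (z - u))))

include hWard hCs hm hω hS in
/-- NOT IN PRINT; OUR BOOKKEEPING.  **ANY SLOT-WARD COMPANION IS LETTER-SIZED OFF THE DIAGONAL, AT THE LETTER's SLOTS** (§2 ⨾ §3): for `x ≠ z`,
`|S₀ x z κ₁ κ₂| ≤ Cs·(Σ_κ (ω (x − e_κ) + ω x))·e^{−m′‖x − z‖₁}` (row form) and `≤ Cs·(Σ_κ (ω (z − e_κ) + ω z))·e^{−m′‖x − z‖₁}` (column form). -/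
theorem abs_companion_le_of_profile {x z : Site (d + 1)} (hxz : x ≠ z) (κ₁ κ₂ : Fin (d + 1)) :
    |S₀ x z (Sum.inl κ₁) (Sum.inl κ₂)| ≤ Cs * (∑ κ : Fin (d + 1), (ω (x - B6BondElimination.unitVec κ) + ω x)) * Real.exp (-m' * l1 (x - z))
    ∧ |S₀ x z (Sum.inl κ₁) (Sum.inl κ₂)| ≤ Cs * (∑ κ : Fin (d + 1), (ω (z - B6BondElimination.unitVec κ) + ω z)) * Real.exp (-m' * l1 (x - z)) := by
  refine ⟨?_, ?_⟩
  · rw [companion_eq_neg_divV_left hWard hxz]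
    exact abs_canonical_companion_le_of_profile hCs hm hω hS x z _ _
  · rw [companion_eq_divV_right hWard hxz]
    exact abs_divV_ff_le_of_profile_right hCs hm hω hS x z _ _

end Both

end Summit.QuantumFields.BalabanUV.Beta.GAN24.SlotWardCompanion

end
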